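/-
Copyright (c) 2026 the pub-hodgecm-mathlib formalisation cell (harness21).  Prover seat hodgecm-mathlib-K2Liu-p07 (g3), Track B «K2-LIT»,
#184♮ = hLiu418 = `stmt-HodgeConjecture-24832`; #42S payer road, organ S1 (local Siegel–Weil spanning), ROAD W letter (R-d) = (ii-gen), algebraic half
(LEAD F0P6-plan (g14) BATCH #16 (2) «(R-d) (ii-gen) = p07»; K2Liu-p01 (g8) SPEC-F7-FrameStep §2 (ii); K2Liu-p10 (g4) 12:48:21Z (prescribed discriminant)).
-/
import Summits.HodgeConjecture.HodgeConjecture.Theorems.K2LiuHyperbolicFrameMatrix    -- ★ p01 (ii-c): `entry_eq`; ★ (ii-a): `herm_single_left∕right`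
import HarnessLib

/-!
# Crux `HLiu418`, #42S organ S1, ROAD W, letter (ii-gen) — algebraic half: A HYPERBOLIC FRAME FROM ANY ISOTROPIC VECTOR, WITH PRESCRIBED DISCRIMINANT
# `P · Dᵀ · σ(P)ᵀ = [[0,1,0],[1,0,0],[0,0,−d₀d₁d₂]]`, `det P = 1`

Cell `hodgecm-mathlib`, crux item hLiu418 = `stmt-HodgeConjecture-24832`; squad K2 ∕ K2Liu; LEAD F0P6-plan (g14), organ lead K2Liu-p06 (g4);
prover K2Liu-p07 (g3).  THEOREMS ONLY (no `def`, no instance, no notation, no named-fact hypothesis, no `sorry`); lane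
`--supports stmt-HodgeConjecture-24832 --as helper`.

WHY.  K2Liu-p01 (g8)'s ★ (ii-a)∕(ii-c) build the `(u,u′,ℓ)`-frame of the ternary hermitian space `h(x,y) = Σ d_k x_k σ(y_k)` from an isotropic vector INSIDE A
COORDINATE PLANE (`u = λe_i + e_j`), which exists at inert unramified places only.  At a ramified place (the F7r road) the isotropic vector is in general
position (★ `K2LiuIsotropicVectorLocal.exists_isotropic_localRing`: every ternary hermitian space over `E ⊗ F_v` is isotropic); this file is the FIELD ALGEBRA
turning ANY isotropic `u ≠ 0` into a frame — dyadic-safe through p01's trace-one letter `t₀ + σt₀ = 1` — and NORMALISES it: `det P = 1`, so the anisotropic entry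
is the prescribed discriminant representative `−d₀d₁d₂` (K2Liu-p10 (g4)'s global `d′` for the (σ) small side, up to his ordering convention).
Construction: `w = e_{k₀}` with `u_{k₀} ≠ 0` (`h(u,w) ≠ 0`), `w₁ = σ(h(u,w))⁻¹·w` (`h(u,w₁) = 1`), `u′ = w₁ − t₀h(w₁,w₁)·u` (`h(u′,u′) = 0`, `h(u,u′) = 1`),
`ℓ₀ = e_{k₁} − h(e_{k₁},u)·u′ − h(e_{k₁},u′)·u` (⊥ `u, u′`; `k₁` with `det(u,u′,e_{k₁}) ≠ 0` — the `2×2` minors of the non-parallel pair `(u,u′)` do not all vanish),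
`ℓ = det(u,u′,ℓ₀)⁻¹·ℓ₀`; then `det P = 1` and `det(P Dᵀ σ(P)ᵀ) = d₀d₁d₂` forces the `(ℓ,ℓ)`-entry to be `−d₀d₁d₂`.
* `herm_add_left`, `herm_sub_left`, `herm_smul_left`, `herm_smul_right`, `herm_comm` — sesquilinearity bookkeeping;
* `exists_det_single_ne_zero` — a non-parallel pair has a non-zero `2×2` minor;  **`exists_hyperbolic_frame_of_isotropic`** — the head.
References: [Scharlau1985HermitianForms] Ch. 7 §6; [Jacobowitz1962] §4; [Shimura1997] §13.2.
HONEST LABEL.  Count-neutral helper: `HC_CM` is proved only modulo the 7 printed citations (2 remaining named inputs: hLiu418 = `stmt-HodgeConjecture-24832`,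
h413 = `stmt-HodgeConjecture-24833`) until rung 0 closes.
-/

set_option autoImplicit false
set_option linter.dupNamespace false -- the mandated namespace repeats `HodgeConjecture.HodgeConjecture`

open Finset Matrix

namespace Summit.HodgeConjecture.HodgeConjecture.Cruxes.HLiu418.K2LiuHyperbolicFrameOfIsotropic

open K2LiuHyperbolicPairOfIsotropicNorm K2LiuHyperbolicFrameMatrix

variable {K : Type*} [Field K] (σ : K →+* K) (d : Fin 3 → K)

/-! ## §1 Sesquilinearity bookkeeping for `h(x,y) = Σ_k d_k x_k σ(y_k)` -/

/-- `h(x + x′, y) = h(x,y) + h(x′,y)`. [folklore] -/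
theorem herm_add_left (x x' y : Fin 3 → K) :
    (∑ k, d k * (x + x') k * σ (y k)) = (∑ k, d k * x k * σ (y k)) + ∑ k, d k * x' k * σ (y k) := by
  rw [← sum_add_distrib]; exact sum_congr rfl fun k _ => by rw [Pi.add_apply]; ring

/-- `h(x − x′, y) = h(x,y) − h(x′,y)`. [folklore] -/
theorem herm_sub_left (x x' y : Fin 3 → K) :
    (∑ k, d k * (x - x') k * σ (y k)) = (∑ k, d k * x k * σ (y k)) - ∑ k, d k * x' k * σ (y k) := by
  rw [← sum_sub_distrib]; exact sum_congr rfl fun k _ => by rw [Pi.sub_apply]; ring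

/-- `h(c·x, y) = c·h(x,y)`. [folklore] -/
theorem herm_smul_left (c : K) (x y : Fin 3 → K) : (∑ k, d k * (c • x) k * σ (y k)) = c * ∑ k, d k * x k * σ (y k) := by
  rw [mul_sum]; exact sum_congr rfl fun k _ => by rw [Pi.smul_apply, smul_eq_mul]; ring

/-- `h(x, y − y′) = h(x,y) − h(x,y′)`. [folklore] -/
theorem herm_sub_right (x y y' : Fin 3 → K) :
    (∑ k, d k * x k * σ ((y - y') k)) = (∑ k, d k * x k * σ (y k)) - ∑ k, d k * x k * σ (y' k) := by
  rw [← sum_sub_distrib]; exact sum_congr rfl fun k _ => by rw [Pi.sub_apply, map_sub]; ring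

/-- `h(x, c·y) = σ(c)·h(x,y)`. [folklore] -/
theorem herm_smul_right (c : K) (x y : Fin 3 → K) : (∑ k, d k * x k * σ ((c • y) k)) = σ c * ∑ k, d k * x k * σ (y k) := by
  rw [mul_sum]; exact sum_congr rfl fun k _ => by rw [Pi.smul_apply, smul_eq_mul, map_mul]; ring

/-- `h(y, x) = σ(h(x, y))` for `σ`-fixed `d` and an involution `σ`. [folklore] -/
theorem herm_comm (hσσ : ∀ x, σ (σ x) = x) (hd : ∀ k, σ (d k) = d k) (x y : Fin 3 → K) :
    (∑ k, d k * y k * σ (x k)) = σ (∑ k, d k * x k * σ (y k)) := by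
  rw [map_sum]; exact sum_congr rfl fun k _ => by rw [map_mul, map_mul, hd, hσσ]; ring

/-! ## §2 A non-parallel pair has a non-zero `2 × 2` minor -/

/-- the three minors. [folklore] -/
theorem det_single_two (u u' : Fin 3 → K) : det (Matrix.of ![u, u', Pi.single 2 1]) = u 0 * u' 1 - u 1 * u' 0 := by
  simp [Matrix.det_fin_three]

/-- the three minors. [folklore] -/
theorem det_single_one (u u' : Fin 3 → K) : det (Matrix.of ![u, u', Pi.single 1 1]) = u 2 * u' 0 - u 0 * u' 2 := by
  simp [Matrix.det_fin_three]; ring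

/-- the three minors. [folklore] -/
theorem det_single_zero (u u' : Fin 3 → K) : det (Matrix.of ![u, u', Pi.single 0 1]) = u 1 * u' 2 - u 2 * u' 1 := by
  simp [Matrix.det_fin_three]

/-- **a pair `(u, u′)` with `h(u,u) = 0`, `h(u,u′) = 1` is NOT parallel, so `det(u, u′, e_k) ≠ 0` for some `k`**. [folklore] -/
theorem exists_det_single_ne_zero {u u' : Fin 3 → K} (hu0 : u ≠ 0) (huu : (∑ k, d k * u k * σ (u k)) = 0)
    (huu' : (∑ k, d k * u k * σ (u' k)) = 1) : ∃ k : Fin 3, det (Matrix.of ![u, u', Pi.single k 1]) ≠ 0 := by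
  by_contra h
  push Not at h
  have h0 := h 0; have h1 := h 1; have h2 := h 2
  rw [det_single_zero] at h0; rw [det_single_one] at h1; rw [det_single_two] at h2
  obtain ⟨k₀, hk₀⟩ := Function.ne_iff.1 hu0
  -- `u′ = c • u` with `c = u′_{k₀} ∕ u_{k₀}`
  have hpar : u' = (u' k₀ / u k₀) • u := by
    funext j
    rw [Pi.smul_apply, smul_eq_mul, div_mul_eq_mul_div, eq_div_iff hk₀]
    fin_cases k₀ <;> fin_cases j <;> simp <;>
      first | linear_combination h0 | linear_combination (-1 : K) * h0 | linear_combination h1 | linear_combination (-1 : K) * h1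
            | linear_combination h2 | linear_combination (-1 : K) * h2
  rw [hpar, herm_smul_right, huu, mul_zero] at huu'
  exact zero_ne_one huu'

/-! ## §3 The frame -/

/-- **A HYPERBOLIC FRAME FROM ANY ISOTROPIC VECTOR, WITH PRESCRIBED DISCRIMINANT.**  `K` a field with an involution `σ`, `h(x,y) = Σ_k d_k x_k σ(y_k)` on `K³` with
`σ`-fixed non-zero `d_k`, a trace-one element `t₀ + σt₀ = 1` (dyadic-safe), and an isotropic `u ≠ 0`.  Then there is `P ∈ SL₃(K)` (rows `u, u′, ℓ`) with
`P · Dᵀ · σ(P)ᵀ = [[0,1,0],[1,0,0],[0,0,−d₀d₁d₂]]` — a hyperbolic pair `(u,u′)` and an anisotropic line of the prescribed discriminant class.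
[cite: Scharlau1985HermitianForms, Ch. 7 §6] [cite: Jacobowitz1962, §4] [cite: Shimura1997, §13.2] -/
theorem exists_hyperbolic_frame_of_isotropic (hσσ : ∀ x, σ (σ x) = x) (hd : ∀ k, σ (d k) = d k) (hd0 : ∀ k, d k ≠ 0)
    {t₀ : K} (ht₀ : t₀ + σ t₀ = 1) {u : Fin 3 → K} (hu0 : u ≠ 0) (huu : (∑ k, d k * u k * σ (u k)) = 0) :
    ∃ P : Matrix (Fin 3) (Fin 3) K, P.det = 1 ∧ P * (diagonal d)ᵀ * (P.map σ)ᵀ = !![0, 1, 0; 1, 0, 0; 0, 0, -(d 0 * d 1 * d 2)] := by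
  -- Step 1: `w₁ = σ(h(u,e_{k₀}))⁻¹ • e_{k₀}` with `h(u, w₁) = 1`
  obtain ⟨k₀, hk₀⟩ := Function.ne_iff.1 hu0
  have hβ : (∑ k, d k * u k * σ ((Pi.single k₀ (1 : K) : Fin 3 → K) k)) = d k₀ * u k₀ := by rw [herm_single_right, map_one, mul_one]
  have hβ0 : d k₀ * u k₀ ≠ 0 := mul_ne_zero (hd0 k₀) hk₀
  set w₁ : Fin 3 → K := σ (d k₀ * u k₀)⁻¹ • (Pi.single k₀ (1 : K) : Fin 3 → K) with hw₁
  clear_value w₁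
  have huw₁ : (∑ k, d k * u k * σ (w₁ k)) = 1 := by
    rw [hw₁, herm_smul_right, hσσ, hβ, inv_mul_cancel₀ hβ0]
  have hw₁u : (∑ k, d k * w₁ k * σ (u k)) = 1 := by rw [herm_comm σ d hσσ hd, huw₁, map_one]
  -- Step 2: `u′ = w₁ − (t₀ γ) • u`, `γ = h(w₁,w₁)`
  set γ : K := ∑ k, d k * w₁ k * σ (w₁ k) with hγ
  clear_value γ
  have hγσ : σ γ = γ := by rw [hγ, ← herm_comm σ d hσσ hd]
  set u' : Fin 3 → K := w₁ - (t₀ * γ) • u with hu'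
  clear_value u'
  have hu'u' : (∑ k, d k * u' k * σ (u' k)) = 0 := by
    rw [hu', herm_sub_left, herm_sub_right, herm_sub_right, herm_smul_left, herm_smul_left, herm_smul_right, herm_smul_right, ← hγ, hw₁u, huw₁,
      huu, map_mul, hγσ]
    linear_combination (-γ) * ht₀
  have huu' : (∑ k, d k * u k * σ (u' k)) = 1 := by
    rw [hu', herm_sub_right, herm_smul_right, huw₁, huu, mul_zero, sub_zero]
  have hu'u : (∑ k, d k * u' k * σ (u k)) = 1 := by rw [herm_comm σ d hσσ hd, huu', map_one]
  -- Step 3: `ℓ₀ = e_{k₁} − h(e_{k₁},u) • u′ − h(e_{k₁},u′) • u ⊥ u, u′`, with `det(u, u′, e_{k₁}) ≠ 0`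
  obtain ⟨k₁, hk₁⟩ := exists_det_single_ne_zero σ d hu0 huu huu'
  set z : Fin 3 → K := Pi.single k₁ (1 : K) with hz
  set ℓ₀ : Fin 3 → K := z - (∑ k, d k * z k * σ (u k)) • u' - (∑ k, d k * z k * σ (u' k)) • u with hℓ₀
  clear_value ℓ₀
  have hℓ₀u : (∑ k, d k * ℓ₀ k * σ (u k)) = 0 := by
    rw [hℓ₀, herm_sub_left, herm_sub_left, herm_smul_left, herm_smul_left, hu'u, huu]; ring
  have hℓ₀u' : (∑ k, d k * ℓ₀ k * σ (u' k)) = 0 := by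
    rw [hℓ₀, herm_sub_left, herm_sub_left, herm_smul_left, herm_smul_left, hu'u', huu']; ring
  have hdet₀ : det (Matrix.of ![u, u', ℓ₀]) = det (Matrix.of ![u, u', z]) := by
    rw [hℓ₀]; simp [Matrix.det_fin_three]; ring
  set δ₀ : K := det (Matrix.of ![u, u', z]) with hδ₀
  have hδ₀0 : δ₀ ≠ 0 := hk₁
  -- Step 4: normalise `ℓ = δ₀⁻¹ • ℓ₀`, so that `det (u, u′, ℓ) = 1`
  set ℓ : Fin 3 → K := δ₀⁻¹ • ℓ₀ with hℓ
  clear_value ℓ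
  have hℓu : (∑ k, d k * ℓ k * σ (u k)) = 0 := by rw [hℓ, herm_smul_left, hℓ₀u, mul_zero]
  have hℓu' : (∑ k, d k * ℓ k * σ (u' k)) = 0 := by rw [hℓ, herm_smul_left, hℓ₀u', mul_zero]
  have huℓ : (∑ k, d k * u k * σ (ℓ k)) = 0 := by rw [herm_comm σ d hσσ hd, hℓu, map_zero]
  have hu'ℓ : (∑ k, d k * u' k * σ (ℓ k)) = 0 := by rw [herm_comm σ d hσσ hd, hℓu', map_zero]
  have hP1 : det (Matrix.of ![u, u', ℓ]) = 1 := by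
    have h1 : det (Matrix.of ![u, u', ℓ]) = δ₀⁻¹ * det (Matrix.of ![u, u', ℓ₀]) := by rw [hℓ]; simp [Matrix.det_fin_three]; ring
    rw [h1, hdet₀, inv_mul_cancel₀ hδ₀0]
  refine ⟨Matrix.of ![u, u', ℓ], hP1, ?_⟩
  -- the Gram matrix has the shape `[[0,1,0],[1,0,0],[0,0,x]]` …
  set x : K := ∑ k, d k * ℓ k * σ (ℓ k) with hx
  have hG : Matrix.of ![u, u', ℓ] * (diagonal d)ᵀ * ((Matrix.of ![u, u', ℓ]).map σ)ᵀ = !![0, 1, 0; 1, 0, 0; 0, 0, x] := by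
    ext i j
    rw [entry_eq]
    fin_cases i <;> fin_cases j <;> simp [huu, huu', hu'u, hu'u', huℓ, hu'ℓ, hℓu, hℓu', hx]
  -- … and its determinant pins `x = −d₀d₁d₂`
  have hdetG : det (Matrix.of ![u, u', ℓ] * (diagonal d)ᵀ * ((Matrix.of ![u, u', ℓ]).map σ)ᵀ) = d 0 * d 1 * d 2 := by
    rw [det_mul, det_mul, det_transpose, det_transpose, det_diagonal, ← RingHom.mapMatrix_apply, ← RingHom.map_det, hP1, map_one, one_mul, mul_one,
      Fin.prod_univ_three]
  have hx' : x = -(d 0 * d 1 * d 2) := by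
    have h := hdetG
    rw [hG] at h
    simp [Matrix.det_fin_three] at h
    linear_combination -h
  rw [hG, hx']

/-- **THE `Q`-FORM (consumer shape of K2Liu-p10 (g4)'s `slice_letter`)**: with the same data, `∃ Q` with `det Q = 1` and `(Q^σ)ᵀ · W₀ · Q = diagonal d`,
`W₀ = [[0,1,0],[1,0,0],[0,0,−d₀d₁d₂]]` — `Q := adj((P^σ)ᵀ) = ((P^σ)ᵀ)⁻¹` for the `P` of `exists_hyperbolic_frame_of_isotropic` (`det P = 1`, `σσ = id`).
[cite: Scharlau1985HermitianForms, Ch. 7 §6; Ch. 1 Lemma 3.4] [cite: Omeara1963, §42] -/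
theorem exists_frame_conjTranspose_mul_eq_diagonal (hσσ : ∀ x, σ (σ x) = x) (hd : ∀ k, σ (d k) = d k) (hd0 : ∀ k, d k ≠ 0)
    {t₀ : K} (ht₀ : t₀ + σ t₀ = 1) {u : Fin 3 → K} (hu0 : u ≠ 0) (huu : (∑ k, d k * u k * σ (u k)) = 0) :
    ∃ Q : Matrix (Fin 3) (Fin 3) K, Q.det = 1 ∧ (Q.map σ)ᵀ * !![0, 1, 0; 1, 0, 0; 0, 0, -(d 0 * d 1 * d 2)] * Q = diagonal d := by
  obtain ⟨P, hP1, hP⟩ := exists_hyperbolic_frame_of_isotropic σ d hσσ hd hd0 ht₀ hu0 huu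
  have hσσ' : (⇑σ ∘ ⇑σ : K → K) = id := funext hσσ
  -- `Q := ((adj P)^σ)ᵀ = adj ((P^σ)ᵀ)`
  refine ⟨((adjugate P).map σ)ᵀ, ?_, ?_⟩
  · rw [det_transpose, ← RingHom.mapMatrix_apply, ← RingHom.map_det, det_adjugate, hP1, one_pow, map_one]
  · have hQσ : ((((adjugate P).map σ)ᵀ).map σ)ᵀ = adjugate P := by
      rw [Matrix.transpose_map, Matrix.transpose_transpose, Matrix.map_map, hσσ', Matrix.map_id]
    have h1 : adjugate P * P = 1 := by rw [adjugate_mul, hP1, one_smul]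
    have h2 : (P.map σ)ᵀ * ((adjugate P).map σ)ᵀ = 1 := by
      rw [← Matrix.transpose_mul, ← Matrix.map_mul, h1, Matrix.map_one _ (map_zero σ) (map_one σ), Matrix.transpose_one]
    rw [hQσ, ← hP]
    calc adjugate P * (P * (diagonal d)ᵀ * (P.map σ)ᵀ) * ((adjugate P).map σ)ᵀ
        = (adjugate P * P) * (diagonal d)ᵀ * ((P.map σ)ᵀ * ((adjugate P).map σ)ᵀ) := by simp only [Matrix.mul_assoc]
      _ = diagonal d := by rw [h1, h2, Matrix.one_mul, Matrix.mul_one, diagonal_transpose]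

end Summit.HodgeConjecture.HodgeConjecture.Cruxes.HLiu418.K2LiuHyperbolicFrameOfIsotropic
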